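import Summits.AtomisticToContinuum.FouriersLaw.Theorems.BondHeatUncertaintyBoundedResponseCommittorCornerA
import HarnessLib

/-!
# BondHeatUncertainty / BoundedResponse — «CommittorCorner» (lens-1 g100 NODE; critic row 1414): part 2 of 2 (sequel of `…CommittorCornerA`, whose module docstring describes the node)

Split for the 400-line cap by the landing lane (hand-2 g37).  This part: §4 the summed committor identity `γ(N−1)h₀ = Σ_b (E_{≤b} − ⟨E_{≤b}⟩) − u_N` with the two fixed-`N`
estimates, and §5 the ladder statements ((W) ∧ CCB(3) ⟹ (C₁); E1 ⟹ (C₁) mod (W); (C₁) ∧ (W) ⟹ CCB(3)) incl. ★ `correctorGrade_one_iff_currentCorrectorBudget_three`.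
Same namespace, section and variables; all FQNs unchanged; bodies verbatim.  0 sorry; standard axioms.
-/

noncomputable section

open MeasureTheory ProbabilityTheory Filter Topology Set
open scoped ENNReal NNReal
open Literature.MathematicalPhysics.KineticTheory.HeatConduction
open Literature.MathematicalPhysics.KineticTheory
open Literature.MathematicalPhysics.KineticTheory.HeatConduction.HardTether (leftEnergy blockWeight bondWeight)
open Summit.AtomisticToContinuum.FouriersLaw.Theorems.SubdiffusiveBondHeat.EscapeGrading
  (CurrentCorrectorBudget currentCorrectorBudget_mono currentCorrectorBudget_two_of_coneScaleCorrector)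
open Summit.AtomisticToContinuum.FouriersLaw.Theorems.BoundedResponse.TransientContact
  (ExtensiveBlockEnergyVariance blockEnergyLeft blockEnergyLeftVar)
open Summit.AtomisticToContinuum.FouriersLaw.Theses.OddSectorIrreversibility (ConeScaleCorrector)
open Summit.AtomisticToContinuum.FouriersLaw.Theses.BondHeatUncertainty (BoundedResponse)
open Summit.AtomisticToContinuum.FouriersLaw.Theorems.SubdiffusiveBondHeat
  (pinnedChain_integrable_exp_mul_hamiltonian_transitionKernel)
open Summit.AtomisticToContinuum.FouriersLaw.Theorems.SubdiffusiveBondHeat.CorrectorBudget (KineticCorrectorBudget)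
open Summit.AtomisticToContinuum.FouriersLaw.Theorems.BoundaryKubo.Negative.Reflection (bondCurrent_eq_zero_of_not_lt)

namespace Summit.AtomisticToContinuum.FouriersLaw.Theorems.BoundedResponse.ParityFloor

variable {ω₂ lam β γ T : ℝ} {N : ℕ}

section CommittorCorner

/-! ## §4 The summed identity `γ(N−1)h₀ = Σ_b (E_{≤b} − ⟨E_{≤b}⟩) − u_N` and the two fixed-`N` estimates -/

/-- **The committor identity, summed over the bonds** (`N ≥ 2`): `μ_T`-a.e.
`γ(N−1)·h₀ = Σ_{i : i+1<N} (E_{≤i} − ⟨E_{≤i}⟩) − u_N`, `u_N = ∫_{(0,∞)} P_s 𝒥 ds` the Kubo corrector of the total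
current (`Σ_i u_i = u_N`, the phantom current of the last site being `0`). This is the discrete gambler's-ruin profile
of the left-heat committor `Q_L = γh₀` against the block energies. [folklore] -/
theorem kinCorrector_committor_ae_eq (hω : 0 < ω₂) (hl : 0 < lam) (hβ : 0 < β) (hγ : 0 < γ) (hT : 0 < T)
    (hN : 2 ≤ N) :
    ∀ᵐ z ∂((pinnedChain ω₂ lam β γ).gibbsMeasure N T),
      γ * ((N : ℝ) - 1) * kinCorrector ω₂ lam β γ T N ⟨0, by omega⟩ z =
        (∑ i ∈ Finset.univ.filter (fun i : Fin N => i.val + 1 < N),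
          (leftEnergy (pinnedChain ω₂ lam β γ) N i z -
            ∫ x, leftEnergy (pinnedChain ω₂ lam β γ) N i x ∂((pinnedChain ω₂ lam β γ).gibbsMeasure N T))) -
        ∫ s in Ioi (0 : ℝ), ∫ y, (∑ i : Fin N, (pinnedChain ω₂ lam β γ).bondCurrent N i y)
          ∂((pinnedChain ω₂ lam β γ).transitionKernel N T T s.toNNReal z) := by
  have hN0 : 0 < N := by omega
  set P := pinnedChain ω₂ lam β γ with hP
  obtain ⟨-, -, husum, -⟩ := totalKubo_facts hω hl hβ hγ hT hN0
  have hid := leftEnergy_sub_mean_ae_eq hω hl hβ hγ hT hN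
  set S : Finset (Fin N) := Finset.univ.filter (fun i : Fin N => i.val + 1 < N) with hS
  have hmemS : ∀ {i : Fin N}, i ∈ S → i.val + 1 < N := fun {i} hi => by simpa [hS] using hi
  have hcardR : (S.card : ℝ) = (N : ℝ) - 1 := by
    rw [hS, card_filter_bond hN0, Nat.cast_sub (by omega), Nat.cast_one]
  filter_upwards [hid] with z hz
  have h1 : (∑ i ∈ S, (leftEnergy P N i z - ∫ x, leftEnergy P N i x ∂(P.gibbsMeasure N T))) =
      ∑ i ∈ S, (γ * kinCorrector ω₂ lam β γ T N ⟨0, by omega⟩ z +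
        ∫ s in Ioi (0 : ℝ), ∫ y, P.bondCurrent N i y ∂(P.transitionKernel N T T s.toNNReal z)) :=
    Finset.sum_congr rfl fun i hi => hz i (hmemS hi)
  have h2 : ∑ i ∈ S, ∫ s in Ioi (0 : ℝ), ∫ y, P.bondCurrent N i y ∂(P.transitionKernel N T T s.toNNReal z) =
      ∫ s in Ioi (0 : ℝ), ∫ y, (∑ i : Fin N, P.bondCurrent N i y) ∂(P.transitionKernel N T T s.toNNReal z) := by
    rw [husum z, ← Finset.sum_filter_add_sum_filter_not Finset.univ (fun i : Fin N => i.val + 1 < N)]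
    have h3 : ∑ i ∈ Finset.univ.filter (fun i : Fin N => ¬ (i.val + 1 < N)),
        ∫ s in Ioi (0 : ℝ), ∫ y, P.bondCurrent N i y ∂(P.transitionKernel N T T s.toNNReal z) = 0 := by
      refine Finset.sum_eq_zero fun i hi => ?_
      have hi' : ¬ (i.val + 1 < N) := (Finset.mem_filter.1 hi).2
      simp [bondCurrent_eq_zero_of_not_lt P hi']
    rw [h3, add_zero]
  rw [h1, Finset.sum_add_distrib, Finset.sum_const, nsmul_eq_mul, hcardR, h2]
  ring

/-- **Fixed-`N` committor estimate, forward.** At one `N ≥ 2`: if every genuine left block energy is in `L²(μ_T)`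
with `∫ (E_{≤i} − ⟨E_{≤i}⟩)² dμ_T ≤ C_W·N`, and the total-current corrector has `∫ u_N² dμ_T ≤ C₃·N³`, then
`∫ h₀² dμ_T ≤ (2/γ²)(C_W + 4C₃)·N` — square the summed identity, Cauchy–Schwarz over the `N − 1` bonds,
`N³ ≤ 4N(N−1)²`. [folklore] -/
theorem sq_kinCorrector_le_of_blockVariance_of_totalKubo (hω : 0 < ω₂) (hl : 0 < lam) (hβ : 0 < β)
    (hγ : 0 < γ) (hT : 0 < T) (hN : 2 ≤ N) {CW C3 : ℝ}
    (hWm : ∀ i : Fin N, i.val + 1 < N →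
      MemLp (leftEnergy (pinnedChain ω₂ lam β γ) N i) 2 ((pinnedChain ω₂ lam β γ).gibbsMeasure N T))
    (hWv : ∀ i : Fin N, i.val + 1 < N →
      ∫ z, (leftEnergy (pinnedChain ω₂ lam β γ) N i z -
          ∫ x, leftEnergy (pinnedChain ω₂ lam β γ) N i x ∂((pinnedChain ω₂ lam β γ).gibbsMeasure N T)) ^ 2
        ∂((pinnedChain ω₂ lam β γ).gibbsMeasure N T) ≤ CW * (N : ℝ))
    (hu : ∫ z, (∫ s in Ioi (0 : ℝ), ∫ y,
        (∑ i : Fin N, (pinnedChain ω₂ lam β γ).bondCurrent N i y)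
          ∂((pinnedChain ω₂ lam β γ).transitionKernel N T T s.toNNReal z)) ^ 2
        ∂((pinnedChain ω₂ lam β γ).gibbsMeasure N T) ≤ C3 * (N : ℝ) ^ 3) :
    ∫ z, kinCorrector ω₂ lam β γ T N ⟨0, by omega⟩ z ^ 2 ∂((pinnedChain ω₂ lam β γ).gibbsMeasure N T) ≤
      2 / γ ^ 2 * (CW + 4 * C3) * (N : ℝ) := by
  have hN0 : 0 < N := by omega
  have hγ0 : γ ≠ 0 := hγ.ne'
  set P := pinnedChain ω₂ lam β γ with hP
  set μT := P.gibbsMeasure N T with hμT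
  haveI : IsProbabilityMeasure μT := pinnedChain_isProbabilityMeasure_gibbsMeasure hω hl.le hβ.le γ N hT
  obtain ⟨h0sm, h0sq, -, -⟩ := corrector_sq_facts hω hl.le hβ hγ hN0 hT (⟨0, hN0⟩ : Fin N)
  obtain ⟨husm, husq, -, -⟩ := totalKubo_facts hω hl hβ hγ hT hN0
  have hAe := kinCorrector_committor_ae_eq hω hl hβ hγ hT hN
  set S : Finset (Fin N) := Finset.univ.filter (fun i : Fin N => i.val + 1 < N) with hS
  have hmemS : ∀ {i : Fin N}, i ∈ S → i.val + 1 < N := fun {i} hi => by simpa [hS] using hi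
  have hcardR : (S.card : ℝ) = (N : ℝ) - 1 := by
    rw [hS, card_filter_bond hN0, Nat.cast_sub (by omega), Nat.cast_one]
  set h0 : PhaseSpace N → ℝ := kinCorrector ω₂ lam β γ T N ⟨0, hN0⟩ with hh0
  set uN : PhaseSpace N → ℝ := fun z => ∫ s in Ioi (0 : ℝ), ∫ y,
      (∑ i : Fin N, P.bondCurrent N i y) ∂(P.transitionKernel N T T s.toNNReal z) with huN
  set dE : Fin N → PhaseSpace N → ℝ := fun i z => leftEnergy P N i z - ∫ x, leftEnergy P N i x ∂μT with hdE
  set A : PhaseSpace N → ℝ := fun z => ∑ i ∈ S, dE i z with hA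
  change Integrable (fun z => uN z ^ 2) μT at husq
  change ∫ z, uN z ^ 2 ∂μT ≤ C3 * (N : ℝ) ^ 3 at hu
  -- integrability
  have hdEm : ∀ i ∈ S, MemLp (dE i) 2 μT := fun i hi => (hWm i (hmemS hi)).sub (memLp_const _)
  have hAm : MemLp A 2 μT := memLp_finsetSum S hdEm
  have hA2 : Integrable (fun z => A z ^ 2) μT := hAm.integrable_sq
  have hdE2 : ∀ i ∈ S, Integrable (fun z => dE i z ^ 2) μT := fun i hi => (hdEm i hi).integrable_sq
  -- `C₃ ≥ 0` (the hypothesis bounds a nonnegative quantity at `N ≥ 2`)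
  have hC3 : 0 ≤ C3 := by
    by_contra h
    push Not at h
    have h1 : C3 * (N : ℝ) ^ 3 < 0 := mul_neg_of_neg_of_pos h (by positivity)
    have h2 : 0 ≤ ∫ z, uN z ^ 2 ∂μT := integral_nonneg fun z => sq_nonneg _
    linarith
  -- `∫ A² ≤ (N−1)² C_W N` (Cauchy–Schwarz over the bonds)
  have hAbound : ∫ z, A z ^ 2 ∂μT ≤ ((N : ℝ) - 1) ^ 2 * (CW * N) := by
    have hpt2 : ∀ z, A z ^ 2 ≤ (S.card : ℝ) * ∑ i ∈ S, dE i z ^ 2 := fun z => sq_sum_le_card_mul_sum_sq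
    have hint2 : Integrable (fun z => (S.card : ℝ) * ∑ i ∈ S, dE i z ^ 2) μT :=
      (integrable_finsetSum S (f := fun i z => dE i z ^ 2) hdE2).const_mul _
    calc ∫ z, A z ^ 2 ∂μT ≤ ∫ z, (S.card : ℝ) * ∑ i ∈ S, dE i z ^ 2 ∂μT := integral_mono hA2 hint2 hpt2
      _ = (S.card : ℝ) * ∑ i ∈ S, ∫ z, dE i z ^ 2 ∂μT := by
          rw [integral_const_mul, integral_finsetSum S (f := fun i z => dE i z ^ 2) hdE2]
      _ ≤ (S.card : ℝ) * (S.card • (CW * (N : ℝ))) := by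
          refine mul_le_mul_of_nonneg_left ?_ (Nat.cast_nonneg _)
          exact Finset.sum_le_card_nsmul S _ _ fun i hi => hWv i (hmemS hi)
      _ = ((N : ℝ) - 1) ^ 2 * (CW * N) := by rw [nsmul_eq_mul, hcardR]; ring
  -- square the summed identity and integrate
  have hpt : ∀ᵐ z ∂μT, (γ * ((N : ℝ) - 1)) ^ 2 * h0 z ^ 2 ≤ 2 * A z ^ 2 + 2 * uN z ^ 2 := by
    filter_upwards [hAe] with z hz
    have e : (γ * ((N : ℝ) - 1)) ^ 2 * h0 z ^ 2 = (A z - uN z) ^ 2 := by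
      rw [show (γ * ((N : ℝ) - 1)) ^ 2 * h0 z ^ 2 = (γ * ((N : ℝ) - 1) * h0 z) ^ 2 by ring, hz]
    rw [e]
    nlinarith [sq_nonneg (A z + uN z)]
  have hI : (γ * ((N : ℝ) - 1)) ^ 2 * ∫ z, h0 z ^ 2 ∂μT ≤ 2 * ∫ z, A z ^ 2 ∂μT + 2 * ∫ z, uN z ^ 2 ∂μT := by
    have hg : Integrable (fun z => 2 * A z ^ 2 + 2 * uN z ^ 2) μT := (hA2.const_mul 2).add (husq.const_mul 2)
    have h := integral_mono_ae (h0sq.const_mul ((γ * ((N : ℝ) - 1)) ^ 2)) hg hpt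
    rw [integral_const_mul, integral_add (hA2.const_mul 2) (husq.const_mul 2), integral_const_mul,
      integral_const_mul] at h
    exact h
  have hD : 0 < (γ * ((N : ℝ) - 1)) ^ 2 := by
    have : (1 : ℝ) ≤ (N : ℝ) - 1 := by
      have h2 : (2 : ℝ) ≤ N := by exact_mod_cast hN
      linarith
    positivity
  have key : (γ * ((N : ℝ) - 1)) ^ 2 * ∫ z, h0 z ^ 2 ∂μT ≤
      (γ * ((N : ℝ) - 1)) ^ 2 * (2 / γ ^ 2 * (CW + 4 * C3) * N) := by
    have hN2 : (2 : ℝ) ≤ N := by exact_mod_cast hN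
    have hcube : (N : ℝ) ^ 3 ≤ 4 * N * ((N : ℝ) - 1) ^ 2 := by nlinarith
    have e : (γ * ((N : ℝ) - 1)) ^ 2 * (2 / γ ^ 2 * (CW + 4 * C3) * N) =
        2 * (((N : ℝ) - 1) ^ 2 * (CW * N)) + 2 * (C3 * (4 * N * ((N : ℝ) - 1) ^ 2)) := by
      field_simp
    rw [e]
    nlinarith [hI, hAbound, hu, mul_le_mul_of_nonneg_left hcube hC3]
  exact le_of_mul_le_mul_left key hD

/-- **Fixed-`N` committor estimate, converse.** At one `N ≥ 2`: the same static input and `∫ h₀² dμ_T ≤ C₁·N` give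
`∫ u_N² dμ_T ≤ (2C_W + 2γ²C₁)·N³` (`u_N = Σ_b δE_{≤b} − γ(N−1)h₀`). [folklore] -/
theorem sq_totalKubo_le_of_blockVariance_of_kinCorrector (hω : 0 < ω₂) (hl : 0 < lam) (hβ : 0 < β)
    (hγ : 0 < γ) (hT : 0 < T) (hN : 2 ≤ N) {CW C1 : ℝ} (hCW : 0 ≤ CW)
    (hWm : ∀ i : Fin N, i.val + 1 < N →
      MemLp (leftEnergy (pinnedChain ω₂ lam β γ) N i) 2 ((pinnedChain ω₂ lam β γ).gibbsMeasure N T))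
    (hWv : ∀ i : Fin N, i.val + 1 < N →
      ∫ z, (leftEnergy (pinnedChain ω₂ lam β γ) N i z -
          ∫ x, leftEnergy (pinnedChain ω₂ lam β γ) N i x ∂((pinnedChain ω₂ lam β γ).gibbsMeasure N T)) ^ 2
        ∂((pinnedChain ω₂ lam β γ).gibbsMeasure N T) ≤ CW * (N : ℝ))
    (h1 : ∫ z, kinCorrector ω₂ lam β γ T N ⟨0, by omega⟩ z ^ 2 ∂((pinnedChain ω₂ lam β γ).gibbsMeasure N T) ≤
      C1 * (N : ℝ)) :
    ∫ z, (∫ s in Ioi (0 : ℝ), ∫ y,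
        (∑ i : Fin N, (pinnedChain ω₂ lam β γ).bondCurrent N i y)
          ∂((pinnedChain ω₂ lam β γ).transitionKernel N T T s.toNNReal z)) ^ 2
        ∂((pinnedChain ω₂ lam β γ).gibbsMeasure N T) ≤ (2 * CW + 2 * γ ^ 2 * C1) * (N : ℝ) ^ 3 := by
  have hN0 : 0 < N := by omega
  set P := pinnedChain ω₂ lam β γ with hP
  set μT := P.gibbsMeasure N T with hμT
  haveI : IsProbabilityMeasure μT := pinnedChain_isProbabilityMeasure_gibbsMeasure hω hl.le hβ.le γ N hT
  obtain ⟨h0sm, h0sq, -, -⟩ := corrector_sq_facts hω hl.le hβ hγ hN0 hT (⟨0, hN0⟩ : Fin N)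
  obtain ⟨husm, husq, -, -⟩ := totalKubo_facts hω hl hβ hγ hT hN0
  have hAe := kinCorrector_committor_ae_eq hω hl hβ hγ hT hN
  set S : Finset (Fin N) := Finset.univ.filter (fun i : Fin N => i.val + 1 < N) with hS
  have hmemS : ∀ {i : Fin N}, i ∈ S → i.val + 1 < N := fun {i} hi => by simpa [hS] using hi
  have hcardR : (S.card : ℝ) = (N : ℝ) - 1 := by
    rw [hS, card_filter_bond hN0, Nat.cast_sub (by omega), Nat.cast_one]
  set h0 : PhaseSpace N → ℝ := kinCorrector ω₂ lam β γ T N ⟨0, hN0⟩ with hh0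
  set uN : PhaseSpace N → ℝ := fun z => ∫ s in Ioi (0 : ℝ), ∫ y,
      (∑ i : Fin N, P.bondCurrent N i y) ∂(P.transitionKernel N T T s.toNNReal z) with huN
  set dE : Fin N → PhaseSpace N → ℝ := fun i z => leftEnergy P N i z - ∫ x, leftEnergy P N i x ∂μT with hdE
  set A : PhaseSpace N → ℝ := fun z => ∑ i ∈ S, dE i z with hA
  change Integrable (fun z => uN z ^ 2) μT at husq
  show ∫ z, uN z ^ 2 ∂μT ≤ (2 * CW + 2 * γ ^ 2 * C1) * (N : ℝ) ^ 3
  have hdEm : ∀ i ∈ S, MemLp (dE i) 2 μT := fun i hi => (hWm i (hmemS hi)).sub (memLp_const _)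
  have hAm : MemLp A 2 μT := memLp_finsetSum S hdEm
  have hA2 : Integrable (fun z => A z ^ 2) μT := hAm.integrable_sq
  have hdE2 : ∀ i ∈ S, Integrable (fun z => dE i z ^ 2) μT := fun i hi => (hdEm i hi).integrable_sq
  have hAbound : ∫ z, A z ^ 2 ∂μT ≤ ((N : ℝ) - 1) ^ 2 * (CW * N) := by
    have hpt2 : ∀ z, A z ^ 2 ≤ (S.card : ℝ) * ∑ i ∈ S, dE i z ^ 2 := fun z => sq_sum_le_card_mul_sum_sq
    have hint2 : Integrable (fun z => (S.card : ℝ) * ∑ i ∈ S, dE i z ^ 2) μT :=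
      (integrable_finsetSum S (f := fun i z => dE i z ^ 2) hdE2).const_mul _
    calc ∫ z, A z ^ 2 ∂μT ≤ ∫ z, (S.card : ℝ) * ∑ i ∈ S, dE i z ^ 2 ∂μT := integral_mono hA2 hint2 hpt2
      _ = (S.card : ℝ) * ∑ i ∈ S, ∫ z, dE i z ^ 2 ∂μT := by
          rw [integral_const_mul, integral_finsetSum S (f := fun i z => dE i z ^ 2) hdE2]
      _ ≤ (S.card : ℝ) * (S.card • (CW * (N : ℝ))) := by
          refine mul_le_mul_of_nonneg_left ?_ (Nat.cast_nonneg _)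
          exact Finset.sum_le_card_nsmul S _ _ fun i hi => hWv i (hmemS hi)
      _ = ((N : ℝ) - 1) ^ 2 * (CW * N) := by rw [nsmul_eq_mul, hcardR]; ring
  have hpt : ∀ᵐ z ∂μT, uN z ^ 2 ≤ 2 * A z ^ 2 + 2 * ((γ * ((N : ℝ) - 1)) ^ 2 * h0 z ^ 2) := by
    filter_upwards [hAe] with z hz
    have e : uN z = A z - γ * ((N : ℝ) - 1) * h0 z := by rw [hz]; ring
    rw [e]
    nlinarith [sq_nonneg (A z + γ * ((N : ℝ) - 1) * h0 z)]
  have hI : ∫ z, uN z ^ 2 ∂μT ≤ 2 * ∫ z, A z ^ 2 ∂μT + 2 * ((γ * ((N : ℝ) - 1)) ^ 2 * ∫ z, h0 z ^ 2 ∂μT) := by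
    have hg : Integrable (fun z => 2 * A z ^ 2 + 2 * ((γ * ((N : ℝ) - 1)) ^ 2 * h0 z ^ 2)) μT :=
      (hA2.const_mul 2).add ((h0sq.const_mul ((γ * ((N : ℝ) - 1)) ^ 2)).const_mul 2)
    have h := integral_mono_ae husq hg hpt
    rw [integral_add (hA2.const_mul 2) ((h0sq.const_mul ((γ * ((N : ℝ) - 1)) ^ 2)).const_mul 2),
      integral_const_mul, integral_const_mul, integral_const_mul] at h
    exact h
  have hN2 : (2 : ℝ) ≤ N := by exact_mod_cast hN
  have hC1 : 0 ≤ C1 * (N : ℝ) := le_trans (integral_nonneg fun z => sq_nonneg (h0 z)) h1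
  have hsq1 : ((N : ℝ) - 1) ^ 2 ≤ (N : ℝ) ^ 2 := by nlinarith
  calc ∫ z, uN z ^ 2 ∂μT ≤ 2 * ∫ z, A z ^ 2 ∂μT + 2 * ((γ * ((N : ℝ) - 1)) ^ 2 * ∫ z, h0 z ^ 2 ∂μT) := hI
    _ ≤ 2 * (((N : ℝ) - 1) ^ 2 * (CW * N)) + 2 * ((γ * ((N : ℝ) - 1)) ^ 2 * (C1 * N)) := by
        have hD0 : 0 ≤ (γ * ((N : ℝ) - 1)) ^ 2 := sq_nonneg _
        nlinarith [hAbound, mul_le_mul_of_nonneg_left h1 hD0]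
    _ ≤ (2 * CW + 2 * γ ^ 2 * C1) * (N : ℝ) ^ 3 := by
        have hCWN : 0 ≤ CW * (N : ℝ) := by positivity
        have hγ2 : 0 ≤ γ ^ 2 := sq_nonneg _
        nlinarith [mul_le_mul_of_nonneg_left hsq1 hCWN, mul_le_mul_of_nonneg_left hsq1 (mul_nonneg hγ2 hC1)]

/-! ## §5 The ladder statements: (W) ∧ CCB(3) ⟹ (C₁); E1 ⟹ (C₁) mod (W); (C₁) ∧ (W) ⟹ CCB(3) -/

/-- **(W) ∧ CCB(3) ⟹ (C₁).** The static extensive block-energy variance `ExtensiveBlockEnergyVariance` (g91, tree) and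
the rung `a = 3` of the current-corrector ladder `CurrentCorrectorBudget` (57c, tree; `∫ u² d(e^{−H/T}dx) ≤ C·N³·Z` for
every a.e.-limit `u` of the finite-horizon Kubo integrals of the total current) imply the corrector grade
`CorrectorGrade 1`, `‖h₀‖²_{L²(μ_{N,T})} ≤ (2/γ²)(C_W + 4C₃)·N` for all `N ≥ 2`. [folklore] -/
theorem correctorGrade_one_of_currentCorrectorBudget_three (hW : ExtensiveBlockEnergyVariance)
    (h3 : CurrentCorrectorBudget 3) : CorrectorGrade 1 := by
  intro ω₂ lam β γ hω hl hβ hγ T hT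
  obtain ⟨CW, hCW⟩ := hW ω₂ lam β γ hω hl hβ hγ T hT
  obtain ⟨C3, hC3⟩ := h3 ω₂ lam β γ hω hl hβ hγ T hT
  refine ⟨2 / γ ^ 2 * (CW + 4 * C3), 2, fun N hN hN2 => ?_⟩
  rw [Real.rpow_one]
  set P := pinnedChain ω₂ lam β γ with hP
  set μT := P.gibbsMeasure N T with hμT
  -- (W) at this `N`, transported to `leftEnergy`
  have hWm : ∀ i : Fin N, i.val + 1 < N → MemLp (leftEnergy P N i) 2 μT := fun i hi => by
    have h := (hCW N i.val hi).1
    rwa [blockEnergyLeft_eq_leftEnergy] at h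
  have hWv : ∀ i : Fin N, i.val + 1 < N →
      ∫ z, (leftEnergy P N i z - ∫ x, leftEnergy P N i x ∂μT) ^ 2 ∂μT ≤ CW * (N : ℝ) := fun i hi => by
    have h := (hCW N i.val hi).2.2.1
    unfold TransientContact.blockEnergyLeftVar at h
    rw [blockEnergyLeft_eq_leftEnergy, variance_eq_integral (hWm i hi).1.aemeasurable] at h
    exact h
  -- CCB(3) at this `N` for `u := u_N`, transported to `μ_T`
  obtain ⟨-, -, -, htend⟩ := totalKubo_facts hω hl hβ hγ hT hN
  set uN : PhaseSpace N → ℝ := fun z => ∫ s in Ioi (0 : ℝ), ∫ y,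
      (∑ i : Fin N, P.bondCurrent N i y) ∂(P.transitionKernel N T T s.toNNReal z) with huN
  set Z : ℝ := ∫ x, Real.exp (-(P.hamiltonian N x) / T) with hZ
  have hZpos : 0 < Z := OddResponseBound.Intensive.integral_gibbsWeight_pos hω hl.le hβ.le γ N hT
  have hsmul := OddResponseBound.Intensive.withDensity_gibbs_eq_smul_gibbsMeasure hω hl.le hβ.le γ N hT
  have hc0 : ENNReal.ofReal Z ≠ 0 := (ENNReal.ofReal_pos.mpr hZpos).ne'
  have hlim : ∀ᵐ x ∂((volume : Measure (PhaseSpace N)).withDensity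
      (fun x => ENNReal.ofReal (Real.exp (-(P.hamiltonian N x) / T)))),
      Tendsto (fun τ : ℝ => ∫ t in Ioc (0 : ℝ) τ,
        (∫ y, (∑ i : Fin N, P.bondCurrent N i y) ∂(P.transitionKernel N T T t.toNNReal x))) atTop
        (𝓝 (uN x)) :=
    (OddResponseBound.Intensive.ae_smul_iff' hsmul hc0).mpr (Eventually.of_forall htend)
  obtain ⟨-, hbound⟩ := hC3 N uN hlim
  rw [OddResponseBound.Intensive.integral_eq_toReal_mul_of_eq_smul hsmul, ENNReal.toReal_ofReal hZpos.le]
    at hbound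
  have h3' : (N : ℝ) ^ (3 : ℝ) = (N : ℝ) ^ 3 := by exact_mod_cast Real.rpow_natCast (N : ℝ) 3
  have hu : ∫ z, uN z ^ 2 ∂μT ≤ C3 * (N : ℝ) ^ 3 := by
    refine le_of_mul_le_mul_left ?_ hZpos
    calc Z * ∫ z, uN z ^ 2 ∂μT ≤ C3 * (N : ℝ) ^ (3 : ℝ) * Z := hbound
      _ = Z * (C3 * (N : ℝ) ^ 3) := by rw [h3']; ring
  exact sq_kinCorrector_le_of_blockVariance_of_totalKubo hω hl hβ hγ hT hN2 hWm hWv hu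

/-- **★ E1 ⟹ (C₁) modulo (W).** The sibling route's staffed rank-2 crux `ConeScaleCorrector` (stmt-14069, `= CCB(2)`)
implies the corrector grade, given the static block-energy variance: `CCB(2) ⟹ CCB(3)` (`currentCorrectorBudget_mono`)
and the previous theorem. So the common `N`-uniform leg (C₁) of both residual items of N_F (11071 ⟸ (D_F) ∧ (C₁),
9121 ⟸ S1r′ ∧ (C₁)) is DOMINATED by E1 ∧ (W). [folklore] -/
theorem correctorGrade_one_of_coneScaleCorrector (hW : ExtensiveBlockEnergyVariance) (hE : ConeScaleCorrector) :
    CorrectorGrade 1 :=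
  correctorGrade_one_of_currentCorrectorBudget_three hW
    (currentCorrectorBudget_mono (by norm_num) (by norm_num) (currentCorrectorBudget_two_of_coneScaleCorrector hE))

/-- The route item `KineticCorrectorBudget` (stmt-33857) from E1 ∧ (W) (GEN 99C's `kineticCorrectorBudget_iff_correctorGrade_one`).
[formal bookkeeping] -/
theorem kineticCorrectorBudget_of_coneScaleCorrector (hW : ExtensiveBlockEnergyVariance) (hE : ConeScaleCorrector) :
    KineticCorrectorBudget :=
  kineticCorrectorBudget_of_correctorGrade_one (correctorGrade_one_of_coneScaleCorrector hW hE)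

/-- **11071 ⟸ (D_F) ∧ E1 ∧ (W)** (door v6 in normal form, GEN 99C `boundedResponse_of_leakPoint_correctorGrade_one`, with
(C₁) supplied by E1 ∧ (W)). [formal bookkeeping] -/
theorem boundedResponse_of_leakPoint_coneScaleCorrector (hW : ExtensiveBlockEnergyVariance) (hF : LeakPoint)
    (hE : ConeScaleCorrector) : BoundedResponse :=
  boundedResponse_of_leakPoint_correctorGrade_one hF (correctorGrade_one_of_coneScaleCorrector hW hE)

/-- **(C₁) ∧ (W) ⟹ CCB(3).** Conversely the corrector grade and the static block variance give the cubic current-corrector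
budget: for `N ≥ 2` every a.e.-limit `u` of the finite-horizon Kubo integrals IS `u_N` a.e. (the integrals converge at
every point), `∫ u_N² dμ_T ≤ (2C_W + 2γ²C₁)N³` by the converse fixed-`N` estimate, and `d(e^{−H/T}dx) = Z·μ_T`; for
`N ≤ 1` there is no bond and `u = 0` a.e. So (C₁) ≡ CCB(3) modulo (W): the corrector grade is the `a = 3` rung of the
existing ladder `E1 = CCB(2) ⟹ CCB(3) ⟹ CCB(1)`-siblings of `…CurrentCorrectorGrading`. [folklore] -/
theorem currentCorrectorBudget_three_of_correctorGrade_one (hW : ExtensiveBlockEnergyVariance)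
    (hC : CorrectorGrade 1) : CurrentCorrectorBudget 3 := by
  intro ω₂ lam β γ hω hl hβ hγ T hT
  obtain ⟨CW, hCW⟩ := hW ω₂ lam β γ hω hl hβ hγ T hT
  obtain ⟨C1, hC10, hC1⟩ := correctorGrade_one_forall hC ω₂ lam β γ hω hl hβ hγ T hT
  refine ⟨2 * max CW 0 + 2 * γ ^ 2 * C1, fun N u hulim => ?_⟩
  set P := pinnedChain ω₂ lam β γ with hP
  set μT := P.gibbsMeasure N T with hμT
  haveI : IsProbabilityMeasure μT := pinnedChain_isProbabilityMeasure_gibbsMeasure hω hl.le hβ.le γ N hT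
  set Z : ℝ := ∫ x, Real.exp (-(P.hamiltonian N x) / T) with hZ
  have hZpos : 0 < Z := OddResponseBound.Intensive.integral_gibbsWeight_pos hω hl.le hβ.le γ N hT
  have hsmul := OddResponseBound.Intensive.withDensity_gibbs_eq_smul_gibbsMeasure hω hl.le hβ.le γ N hT
  have hc0 : ENNReal.ofReal Z ≠ 0 := (ENNReal.ofReal_pos.mpr hZpos).ne'
  have hctop : ENNReal.ofReal Z ≠ ⊤ := ENNReal.ofReal_ne_top
  have hCpos : 0 ≤ 2 * max CW 0 + 2 * γ ^ 2 * C1 := by positivity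
  have h3' : (N : ℝ) ^ (3 : ℝ) = (N : ℝ) ^ 3 := by exact_mod_cast Real.rpow_natCast (N : ℝ) 3
  rw [OddResponseBound.Intensive.memLp_iff_of_eq_smul hsmul hc0 hctop,
    OddResponseBound.Intensive.integral_eq_toReal_mul_of_eq_smul hsmul, ENNReal.toReal_ofReal hZpos.le, h3']
  have hlimT := (OddResponseBound.Intensive.ae_smul_iff' hsmul hc0).mp hulim
  rcases Nat.lt_or_ge N 2 with hN2 | hN2
  · -- `N ≤ 1`: no bond, the Kubo integrands vanish, `u = 0` a.e.
    have hJ0 : ∀ i : Fin N, P.bondCurrent N i = fun _ => 0 := fun i =>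
      funext (bondCurrent_eq_zero_of_not_lt P (by have := i.isLt; omega))
    have hu0 : u =ᵐ[μT] 0 := by
      filter_upwards [hlimT] with x hx
      simp only [hJ0, Finset.sum_const_zero, integral_zero] at hx
      exact tendsto_nhds_unique hx tendsto_const_nhds
    have hu20 : (fun x => u x ^ 2) =ᵐ[μT] fun _ => 0 := hu0.mono fun x hx => by simp [hx]
    refine ⟨(MeasureTheory.MemLp.zero' ).ae_eq hu0.symm, ?_⟩
    rw [integral_congr_ae hu20, integral_zero, mul_zero]
    positivity
  · -- `N ≥ 2`
    obtain ⟨husm, husq, -, htend⟩ := totalKubo_facts hω hl hβ hγ hT (by omega : 0 < N)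
    set uN : PhaseSpace N → ℝ := fun z => ∫ s in Ioi (0 : ℝ), ∫ y,
        (∑ i : Fin N, P.bondCurrent N i y) ∂(P.transitionKernel N T T s.toNNReal z) with huN
    change StronglyMeasurable uN at husm
    change Integrable (fun z => uN z ^ 2) μT at husq
    have hueq : u =ᵐ[μT] uN := by
      filter_upwards [hlimT] with x hx
      exact tendsto_nhds_unique hx (htend x)
    have huNm : MemLp uN 2 μT := (memLp_two_iff_integrable_sq husm.aestronglyMeasurable).2 husq
    refine ⟨huNm.ae_eq hueq.symm, ?_⟩
    rw [integral_congr_ae (hueq.mono fun x hx => by simp only [hx] : (fun x => u x ^ 2) =ᵐ[μT] fun x => uN x ^ 2)]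
    -- (W) at this `N`
    have hWm : ∀ i : Fin N, i.val + 1 < N → MemLp (leftEnergy P N i) 2 μT := fun i hi => by
      have h := (hCW N i.val hi).1
      rwa [blockEnergyLeft_eq_leftEnergy] at h
    have hWv : ∀ i : Fin N, i.val + 1 < N →
        ∫ z, (leftEnergy P N i z - ∫ x, leftEnergy P N i x ∂μT) ^ 2 ∂μT ≤ max CW 0 * (N : ℝ) := fun i hi => by
      have h := (hCW N i.val hi).2.2.1
      unfold TransientContact.blockEnergyLeftVar at h
      rw [blockEnergyLeft_eq_leftEnergy, variance_eq_integral (hWm i hi).1.aemeasurable] at h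
      exact h.trans (mul_le_mul_of_nonneg_right (le_max_left _ _) (Nat.cast_nonneg _))
    have hcore := sq_totalKubo_le_of_blockVariance_of_kinCorrector hω hl hβ hγ hT hN2 (le_max_right CW 0)
      hWm hWv (hC1 N (by omega))
    change ∫ z, uN z ^ 2 ∂μT ≤ (2 * max CW 0 + 2 * γ ^ 2 * C1) * (N : ℝ) ^ 3 at hcore
    calc Z * ∫ z, uN z ^ 2 ∂μT ≤ Z * ((2 * max CW 0 + 2 * γ ^ 2 * C1) * (N : ℝ) ^ 3) :=
          mul_le_mul_of_nonneg_left hcore hZpos.le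
      _ = (2 * max CW 0 + 2 * γ ^ 2 * C1) * (N : ℝ) ^ 3 * Z := by ring

/-- **(C₁) ⟺ CCB(3) modulo (W)** — the corrector grade placed on the current-corrector ladder. [formal bookkeeping] -/
theorem correctorGrade_one_iff_currentCorrectorBudget_three (hW : ExtensiveBlockEnergyVariance) :
    CorrectorGrade 1 ↔ CurrentCorrectorBudget 3 :=
  ⟨currentCorrectorBudget_three_of_correctorGrade_one hW, correctorGrade_one_of_currentCorrectorBudget_three hW⟩

end CommittorCorner

end Summit.AtomisticToContinuum.FouriersLaw.Theorems.BoundedResponse.ParityFloor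

end
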